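import Summits.Ventures.Crystal3D.Bulk.GapSubHullRotation
import Summits.Ventures.Crystal3D.Bulk.GapTightConnected
import HarnessLib

/-!
# The corners of the tight map read in the hull fan of ANY ambient direction set are the
# intrinsic oriented gaps (route 1 of `HOME/lean/lemmaL/DESIGN.md`, step R1.4)

HONEST FRAMING. Part of the venture `Summits/Ventures/Crystal3D` (cell `pub-crystal3d`, phase 2;
seat p3). Kernel lemmas about an admissible fourteen-ball configuration `c` with
`intruderDist c < 3/2`; nothing here asserts anything about GAP(1.26). `X`-generic form of the
corner identification of `Bulk/GapTightConnected.lean` (written there for `dirSet c`): for an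
arbitrary finite ambient `X ⊂ S²` (unit vectors, `0` interior to the hull, every tight dart an
`X`-hull dart) —

* `IsGapConfig.hullSucc_firstReturn_sum_of` — first return of `σ_H = hullSucc X` to the tight
  darts with the swept fan angles summing to `odartGap c i j`;
* **`IsGapConfig.cornerAt_tightDartsIn_of`** — `cornerAt (rot X) (fan angles of X)
  (tightDartsIn c X) d = odartGap c i j` for a tight dart `d ↦ (i, j)`: the corner of the tight
  sub-map is the SAME real number in every ambient fan;
* **`CensusRows.cornerAt_tightDartsIn_lt_pi`** — hence at a census configuration every corner of
  the tight sub-map is `< π` in any ambient fan (P-L2(a), `CensusRows.odartGap_lt_pi`), and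
  `CensusRows.cornerAt_tightDartsIn_pos`: `> 0` — the standing "all corners convex" hypothesis of
  the ear induction for LEMMA L on the ACTIVE hull.
-/

noncomputable section

namespace Summit.Ventures.Crystal3D

open Literature.Geometry.DiscreteGeometry Finset Equiv HullRotSys Real InnerProductGeometry

variable {c : Fin 14 → EuclideanSpace ℝ (Fin 3)} {X : Finset (EuclideanSpace ℝ (Fin 3))}

/-! ## First return with the swept fan angles summed, in any ambient fan -/

/-- **First return of `σ_H` to the tight darts, with the swept fan angles summed**: for `i ≠ 0`
and a tight partner `j` there is `n ≥ 1` with `σ_H^[n] (u_i, u_j) = (u_i, u_{onextNbr c i j})`,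
no earlier positive iterate tight, and the fan angles of the `n` swept sectors summing to
`odartGap c i j`. (The `X`-generic form of `IsGapConfig.hullSucc_firstReturn_sum`.) -/
theorem IsGapConfig.hullSucc_firstReturn_sum_of (hc : IsGapConfig c)
    (hD : intruderDist c < 3 / 2) (hX1 : ∀ y ∈ X, ‖y‖ = 1)
    (h0 : (0 : EuclideanSpace ℝ (Fin 3)) ∈ interior (convexHull ℝ (X : Set _)))
    {i : Fin 14} (hi0 : i ≠ 0)
    (hT : ∀ j ∈ tightNbrs c i, (gapDir c i, gapDir c j) ∈ hullDarts X)
    {j : Fin 14} (hj : j ∈ tightNbrs c i) :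
    ∃ n : ℕ, 0 < n ∧
      (hullSucc X)^[n] (gapDir c i, gapDir c j) =
        (gapDir c i, gapDir c (onextNbr c i j)) ∧
      (∀ m : ℕ, 0 < m → m < n →
        ((hullSucc X)^[m] (gapDir c i, gapDir c j)).2 ∉
          (tightNbrs c i).image (gapDir c)) ∧
      ∑ t ∈ range n, fanAngle X ((hullSucc X)^[t] (gapDir c i, gapDir c j)) =
        odartGap c i j := by
  classical
  have hD3 := hc.sq_lt_three_of_lt hD
  have hy : ‖gapDir c i‖ = 1 := hc.norm_gapDir hi0
  have hfan : gapDir c j ∈ fanNbrs X (gapDir c i) :=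
    mk_mem_hullDarts_iff.1 (hT j hj)
  obtain ⟨E⟩ := nonempty_nbrEnum hX1 hy ⟨gapDir c j, hfan⟩
  obtain ⟨k, hd⟩ := hc.exists_card_tightAngles_eq_succ hD3 hi0 ⟨j, hj⟩
  obtain ⟨m, rfl⟩ := hc.exists_tightNbrAt_eq hD3 hi0 hd hj
  have hsurj : ∀ p : Fin (k + 1), ∃ q : ℕ, q < E.d ∧ E.nb q = gapDir c (tightNbrAt c i hd p) :=
    fun p => E.surj _ (mk_mem_hullDarts_iff.1 (hT _ (tightNbrAt_mem c i hd p)))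
  choose K hK using hsurj
  have hKm : K m < E.d := (hK m).1
  have hK0 : K 0 < E.d := (hK 0).1
  have hKlast : K (Fin.last k) < E.d := (hK (Fin.last k)).1
  -- the position map `K` is an order isomorphism onto the tight positions
  have haz : ∀ p, azimuth (gapDir c i) hy (E.nb (K p)) = sortedTightAngle c i hd p := fun p => by
    rw [(hK p).2, ← hc.tightAzimuth_eq hi0, tightAzimuth_tightNbrAt]
  have hKlt : ∀ p q, p < q → K p < K q := by
    intro p q hpq
    by_contra hle
    rw [not_lt] at hle
    have hs : sortedTightAngle c i hd p < sortedTightAngle c i hd q :=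
      (sortedTightAngle c i hd).strictMono hpq
    rw [← haz p, ← haz q] at hs
    rcases hle.lt_or_eq with hlt | heq
    · exact absurd hs (not_lt.2 (E.mono _ _ hlt (hK p).1).le)
    · rw [heq] at hs; exact lt_irrefl _ hs
  have hrefl : ∀ p q, K p < K q → p < q := by
    intro p q hpq
    by_contra hle
    rw [not_lt] at hle
    rcases hle.lt_or_eq with hlt | heq
    · exact absurd hpq (not_lt.2 (hKlt _ _ hlt).le)
    · rw [heq] at hpq; exact lt_irrefl _ hpq
  have hrec : ∀ q, q < E.d → E.nb q ∈ (tightNbrs c i).image (gapDir c) → ∃ p : Fin (k + 1),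
      K p = q := by
    intro q hq ht
    obtain ⟨j', hj', hjq⟩ := mem_image.1 ht
    obtain ⟨p, rfl⟩ := hc.exists_tightNbrAt_eq hD3 hi0 hd hj'
    refine ⟨p, E.nb_inj (hK p).1 hq ?_⟩
    rw [(hK p).2, hjq]
  have hlift : ∀ p, liftAz E (K p) = sortedTightAngle c i hd p := fun p => by
    rw [liftAz_of_lt E (hK p).1, haz]
  have hd0 := E.d_pos
  -- the weight of a sector in terms of the enumeration
  have hwt : ∀ q, fanAngle X (gapDir c i, E.nb q) =
      angle (perpTo (gapDir c i) (E.nb q)) (perpTo (gapDir c i) (succV X (gapDir c i)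
        (E.nb q))) := fun q => rfl
  rw [← (hK m).2]
  rcases frameDet_eq_one_or c i with hdet1 | hdetm
  · -- right-handed frame: `σ_H` and `onextNbr = nextNbr` both step FORWARD in azimuth
    have hdet : 0 < orient3 (tangentFrame (gapDir c i) hy 0) (tangentFrame (gapDir c i) hy 1)
        (tangentFrame (gapDir c i) hy 2) := by rw [← frameDet_eq hy, hdet1]; exact one_pos
    have hit := iterate_hullSucc_nb_of_det_pos hX1 h0 E hdet
    have honext : onextNbr c i (tightNbrAt c i hd m) = tightNbrAt c i hd (finRotate (k + 1) m) := by
      unfold onextNbr; rw [if_pos hdet1, nextNbr_tightNbrAt]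
    have hgap : odartGap c i (tightNbrAt c i hd m) = tightGap c i hd m := by
      unfold odartGap; rw [if_pos hdet1, dartGap_tightNbrAt]
    -- the swept fan angles telescope along the lifted azimuth
    have hsum : ∀ n, ∑ t ∈ range n, fanAngle X
        ((hullSucc X)^[t] (gapDir c i, E.nb (K m))) = liftAz E (K m + n) - liftAz E (K m) := by
      intro n
      rw [← sum_angle_nb_eq_liftAz_sub hX1 h0 E (K m) n]
      refine Finset.sum_congr rfl fun t _ => ?_
      rw [hit, hwt, succV_nb_of_det_pos hX1 h0 E hdet]
    rw [honext, ← (hK (finRotate (k + 1) m)).2, hgap]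
    by_cases hlast : m = Fin.last k
    · -- wrap-around: the successor is position `0`
      have hrot : finRotate (k + 1) m = 0 := by rw [hlast]; exact finRotate_last
      rw [hrot]
      refine ⟨E.d - K m + K 0, by have := (hK m).1; omega, ?_, ?_, ?_⟩
      · rw [hit, show K m + (E.d - K m + K 0) = K 0 + E.d by have := (hK m).1; omega,
          E.periodic]
      · intro n hn0 hn ht
        rw [hit] at ht
        simp only at ht
        by_cases hlt : K m + n < E.d
        · obtain ⟨p, hp⟩ := hrec _ hlt ht
          have : m < p := hrefl m p (by omega)
          rw [hlast] at this
          exact absurd this (not_lt.2 (Fin.le_last p))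
        · have hper : E.nb (K m + n) = E.nb (K m + n - E.d) := by
            conv_lhs => rw [show K m + n = (K m + n - E.d) + E.d by omega, E.periodic]
          rw [hper] at ht
          obtain ⟨p, hp⟩ := hrec _ (by omega) ht
          have : p < 0 := hrefl p 0 (by omega)
          exact absurd this (not_lt.2 (Fin.zero_le p))
      · rw [hsum, show K m + (E.d - K m + K 0) = K 0 + E.d by have := (hK m).1; omega,
          liftAz_add_d, hlift, hlift, hlast]
        unfold tightGap
        rw [if_pos rfl, finRotate_last]
        ring
    · -- interior: the successor is position `m + 1`
      have hval : ((finRotate (k + 1) m : Fin (k + 1)) : ℕ) = (m : ℕ) + 1 := by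
        rw [finRotate_apply, Fin.val_add_one, if_neg hlast]
      have hmlt : m < finRotate (k + 1) m := by
        rw [Fin.lt_def, hval]; exact Nat.lt_succ_self _
      have hKml : K m < K (finRotate (k + 1) m) := hKlt _ _ hmlt
      refine ⟨K (finRotate (k + 1) m) - K m, by omega, ?_, ?_, ?_⟩
      · rw [hit, Nat.add_sub_cancel' hKml.le]
      · intro n hn0 hn ht
        rw [hit] at ht
        simp only at ht
        obtain ⟨p, hp⟩ := hrec _ (by have := (hK (finRotate (k + 1) m)).1; omega) ht
        have h1 : m < p := hrefl m p (by omega)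
        have h2 : p < finRotate (k + 1) m := hrefl p _ (by omega)
        rw [Fin.lt_def] at h1 h2
        omega
      · rw [hsum, Nat.add_sub_cancel' hKml.le, hlift, hlift]
        unfold tightGap
        rw [if_neg hlast]
        ring
  · -- left-handed frame: `σ_H` and `onextNbr = prevNbr` both step BACKWARD in azimuth
    have hne1 : frameDet c i ≠ 1 := by rw [hdetm]; norm_num
    have hdet : orient3 (tangentFrame (gapDir c i) hy 0) (tangentFrame (gapDir c i) hy 1)
        (tangentFrame (gapDir c i) hy 2) < 0 := by
      rw [← frameDet_eq hy, hdetm]; norm_num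
    have hit := fun n q (h : n ≤ q) =>
      iterate_hullSucc_nb_of_det_neg hX1 h0 E hdet (n := n) (k := q) h
    have honext : onextNbr c i (tightNbrAt c i hd m) =
        tightNbrAt c i hd ((finRotate (k + 1)).symm m) := by
      unfold onextNbr; rw [if_neg hne1, prevNbr_tightNbrAt]
    set m' := (finRotate (k + 1)).symm m with hm'
    have hmm' : m = finRotate (k + 1) m' := by rw [hm', Equiv.apply_symm_apply]
    have hgap : odartGap c i (tightNbrAt c i hd m) = tightGap c i hd m' := by
      unfold odartGap; rw [if_neg hne1, prevNbr_tightNbrAt, ← hm', dartGap_tightNbrAt]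
    -- the swept fan angles telescope (downwards) along the lifted azimuth
    have hsum : ∀ n, n ≤ K m + E.d → ∑ t ∈ range n, fanAngle X
        ((hullSucc X)^[t] (gapDir c i, E.nb (K m + E.d))) =
          liftAz E (K m + E.d) - liftAz E (K m + E.d - n) := by
      intro n hn
      have hterm : ∀ t ∈ range n, fanAngle X
          ((hullSucc X)^[t] (gapDir c i, E.nb (K m + E.d))) =
            liftAz E (K m + E.d - n + (n - 1 - t) + 1) - liftAz E (K m + E.d - n + (n - 1 - t)) := by
        intro t ht
        rw [mem_range] at ht
        rw [hit t _ (by omega), hwt, show K m + E.d - t = (K m + E.d - n + (n - 1 - t)) + 1 by omega,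
          succV_nb_of_det_neg hX1 h0 E hdet, angle_comm, angle_nb_succ_eq_liftAz_sub hX1 h0 E]
      rw [Finset.sum_congr rfl hterm, Finset.sum_range_reflect (fun t =>
        liftAz E (K m + E.d - n + t + 1) - liftAz E (K m + E.d - n + t)) n]
      have h := Finset.sum_range_sub (fun t => liftAz E (K m + E.d - n + t)) n
      simp only [Nat.add_zero] at h
      rw [show K m + E.d - n + n = K m + E.d by omega] at h
      rw [← h]
      exact Finset.sum_congr rfl fun t _ => by rw [Nat.add_assoc]
    rw [honext, ← (hK m').2, hgap]
    have hstart : E.nb (K m) = E.nb (K m + E.d) := (E.periodic _).symm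
    rw [hstart]
    by_cases hlast : m' = Fin.last k
    · -- wrap-around: `m = 0`, the predecessor is the LAST position
      have hm0 : m = 0 := by rw [hmm', hlast]; exact finRotate_last
      refine ⟨K m + E.d - K m', by have := (hK m').1; omega, ?_, ?_, ?_⟩
      · rw [hit _ _ (by omega), show K m + E.d - (K m + E.d - K m') = K m' by
          have := (hK m').1; omega]
      · intro n hn0 hn ht
        rw [hit _ _ (by have := (hK m').1; omega)] at ht
        simp only at ht
        by_cases hge : E.d ≤ K m + E.d - n
        · have hper : E.nb (K m + E.d - n) = E.nb (K m + E.d - n - E.d) := by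
            conv_lhs => rw [show K m + E.d - n = (K m + E.d - n - E.d) + E.d by omega, E.periodic]
          rw [hper] at ht
          obtain ⟨p, hp⟩ := hrec _ (by omega) ht
          have : p < m := hrefl p m (by omega)
          rw [hm0] at this
          exact absurd this (not_lt.2 (Fin.zero_le p))
        · obtain ⟨p, hp⟩ := hrec _ (by omega) ht
          have : m' < p := hrefl m' p (by have := (hK m').1; omega)
          rw [hlast] at this
          exact absurd this (not_lt.2 (Fin.le_last p))
      · rw [hsum _ (by have := (hK m').1; omega), show K m + E.d - (K m + E.d - K m') = K m' by
          have := (hK m').1; omega, liftAz_add_d, hlift, hlift, hlast, hm0]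
        unfold tightGap
        rw [if_pos rfl, finRotate_last]
        ring
    · -- interior: `m = m' + 1`, the predecessor is position `m'`
      have hval : ((m : Fin (k + 1)) : ℕ) = (m' : ℕ) + 1 := by
        rw [hmm', finRotate_apply, Fin.val_add_one, if_neg hlast]
      have hm'lt : m' < m := by rw [Fin.lt_def, hval]; exact Nat.lt_succ_self _
      have hKml : K m' < K m := hKlt _ _ hm'lt
      refine ⟨K m - K m', by omega, ?_, ?_, ?_⟩
      · rw [hit _ _ (by omega), show K m + E.d - (K m - K m') = K m' + E.d by omega, E.periodic]
      · intro n hn0 hn ht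
        rw [hit _ _ (by omega), show K m + E.d - n = (K m - n) + E.d by omega, E.periodic] at ht
        simp only at ht
        obtain ⟨p, hp⟩ := hrec _ (by have := (hK m).1; omega) ht
        have h1 : m' < p := hrefl m' p (by omega)
        have h2 : p < m := hrefl p m (by omega)
        rw [Fin.lt_def] at h1 h2
        omega
      · rw [hsum _ (by omega), show K m + E.d - (K m - K m') = K m' + E.d by omega,
          liftAz_add_d, liftAz_add_d, hlift, hlift]
        unfold tightGap
        rw [if_neg hlast, ← hmm']
        ring

/-- **The corner of the tight sub-map at a tight dart is the oriented gap**: for a tight dart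
`d ↦ (i, j)`, the corner `cornerAt σ_H (fan angles) (tight darts) d` — the fan angles swept
from the arc `i → j` to the next tight arc at `i`, in the hull fan of ANY ambient `X` — equals the
intrinsic oriented gap `odartGap c i j`. -/
theorem IsGapConfig.cornerAt_tightDartsIn_of (hc : IsGapConfig c) (hD : intruderDist c < 3 / 2)
    (hX1 : ∀ y ∈ X, ‖y‖ = 1)
    (h0 : (0 : EuclideanSpace ℝ (Fin 3)) ∈ interior (convexHull ℝ (X : Set _)))
    (hT : ∀ q ∈ darts c, dirPair c q ∈ hullDarts X)
    {q : Fin 14 × Fin 14} (hq : q ∈ darts c) {d : ↥(hullDarts X)} (hd : d.1 = dirPair c q) :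
    RotSys.cornerAt (rot hX1 h0) (dartWeight X) (tightDartsIn c X) d = odartGap c q.1 q.2 := by
  have hD2 : intruderDist c < 2 := by linarith
  obtain ⟨hi0, -, -, -⟩ := mem_darts.1 hq
  have hj : q.2 ∈ tightNbrs c q.1 := snd_mem_tightNbrs_of_mem_darts hq
  obtain ⟨n, hn0, hit, hmin, hsum⟩ :=
    hc.hullSucc_firstReturn_sum_of hD hX1 h0 hi0 (tight_mem_hullDarts_of hT hi0) hj
  have hq' : (q.1, onextNbr c q.1 q.2) ∈ darts c :=
    mk_mem_darts hi0 (hc.onextNbr_mem (hc.sq_lt_three_of_lt hD) hi0 hj)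
  have hdT : d ∈ tightDartsIn c X := mem_tightDartsIn.2 ⟨q, hq, hd.symm⟩
  -- the first return of `σ_H` on the dart type lands in the tight darts at time `n`
  have hret : RotSys.retTime (rot hX1 h0) (tightDartsIn c X) d = n := by
    refine RotSys.retTime_eq_of_first_return _ hdT hn0 ?_ ?_
    · refine mem_tightDartsIn.2 ⟨_, hq', ?_⟩
      rw [rot_pow_apply_val, hd]
      exact hit.symm
    · intro m hm0 hmn hmem
      obtain ⟨q', hq'd, hq'e⟩ := mem_tightDartsIn.1 hmem
      rw [rot_pow_apply_val, hd] at hq'e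
      have hfst : gapDir c q'.1 = gapDir c q.1 := by
        have := congrArg Prod.fst hq'e
        rw [iterate_hullSucc_fst] at this
        exact this
      have hq'1 : q'.1 = q.1 := hc.eq_of_gapDir_eq hD2 (mem_darts.1 hq'd).1 hi0 hfst
      apply hmin m hm0 hmn
      have hq'e' : (hullSucc X)^[m] (gapDir c q.1, gapDir c q.2) = dirPair c q' :=
        hq'e.symm
      rw [hq'e']
      exact mem_image.2 ⟨q'.2, hq'1 ▸ snd_mem_tightNbrs_of_mem_darts hq'd, rfl⟩
  unfold RotSys.cornerAt
  rw [hret, ← hsum]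
  refine Finset.sum_congr rfl fun t _ => ?_
  rw [dartWeight_apply, rot_pow_apply_val, hd]
  rfl

/-! ## The corners of the tight sub-map at a census configuration -/

/-- **Every corner of the tight sub-map is `< π`, in any ambient fan** (P-L2(a)). -/
theorem CensusRows.cornerAt_tightDartsIn_lt_pi (h : CensusRows c) (hX1 : ∀ y ∈ X, ‖y‖ = 1)
    (h0 : (0 : EuclideanSpace ℝ (Fin 3)) ∈ interior (convexHull ℝ (X : Set _)))
    (hT : ∀ q ∈ darts c, dirPair c q ∈ hullDarts X) {d : ↥(hullDarts X)}
    (hd : d ∈ tightDartsIn c X) :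
    RotSys.cornerAt (rot hX1 h0) (dartWeight X) (tightDartsIn c X) d < π := by
  obtain ⟨q, hq, hqd⟩ := mem_tightDartsIn.1 hd
  rw [h.isGapConfig.cornerAt_tightDartsIn_of h.intruderDist_lt_three_halves hX1 h0 hT hq hqd.symm]
  exact h.odartGap_lt_pi (mem_darts.1 hq).1 (snd_mem_tightNbrs_of_mem_darts hq)

/-- Every corner of the tight sub-map is `> 0`, in any ambient fan. -/
theorem CensusRows.cornerAt_tightDartsIn_pos (h : CensusRows c) (hX1 : ∀ y ∈ X, ‖y‖ = 1)
    (h0 : (0 : EuclideanSpace ℝ (Fin 3)) ∈ interior (convexHull ℝ (X : Set _)))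
    (hT : ∀ q ∈ darts c, dirPair c q ∈ hullDarts X) {d : ↥(hullDarts X)}
    (hd : d ∈ tightDartsIn c X) :
    0 < RotSys.cornerAt (rot hX1 h0) (dartWeight X) (tightDartsIn c X) d := by
  obtain ⟨q, hq, hqd⟩ := mem_tightDartsIn.1 hd
  rw [h.isGapConfig.cornerAt_tightDartsIn_of h.intruderDist_lt_three_halves hX1 h0 hT hq hqd.symm]
  exact odartGap_pos c q.1 q.2

end Summit.Ventures.Crystal3D
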